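import Literature.Probability.Percolation.CutBlocksSymm
import HarnessLib

/-!
# Clean windows on a single wall face of the zones of a cut

Topic `Probability/Percolation`.  Support file (proofs, no named fact) for the named fact
`SchrammSmirnov2011_thm_1_7` (zone geometry of the proof of Prop. 4.1, Ann. Probab. 39 (2011), §4):
a WALL FACE of the inner wall of `CutBlocks.zones` is a tube block `z` whose upper neighbour is not a
tube block (`WallFace`); in the columns STRICTLY inside block `z` the tube/collar pattern across the
top edge is that of a half-plane (`mem_Nset_iff_of_wallFace`, `mem_Kset_iff_of_wallFace`), so the
down-shifted collar datum has a clean straight window at every position whose box fits strictly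
inside the columns of the block (`cleanWindow_of_wallFace`) — no flatness of the neighbouring faces
is needed, which lets the landing count run wall face by wall face (windows near the two ends of a
face are treated as corner windows).  The lower faces follow by reflection (`WallFaceBottom`,
`cleanWindow_of_wallFaceBottom`); left and right faces by transposition.

## References

* O. Schramm, S. Smirnov, *On the scaling limits of planar percolation*, Ann. Probab. 39 (2011)
  1768–1814, arXiv:1101.5820, §4, proof of Prop. 4.1. [SchrammSmirnov2011]
-/

noncomputable section

open Set Metric
open Literature.Probability.LatticeModels
open scoped ComplexConjugate

namespace Literature.Probability.Percolation

namespace CutBlocks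

open SSContinuity (swapC)

variable {s : ℝ} {α : Set ℂ} {δ : ℝ}

/-- **A wall face of the upper inner wall**: a tube block whose upper neighbour is not a tube block. [folklore] -/
structure WallFace (s : ℝ) (α : Set ℂ) (z : ℤ × ℤ) : Prop where
  mem : z ∈ tubeBlocks s α
  up : (z.1, z.2 + 1) ∉ tubeBlocks s α

/-- A point strictly inside the columns of block `z` lies only in blocks of that column. [folklore] -/
theorem fst_eq_of_mem_block_of_strict (hs : 0 < s) {z b : ℤ × ℤ} {w : ℂ} (hw : w ∈ block s b)
    (h1 : s * z.1 < w.re) (h2 : w.re < s * (z.1 + 1)) : b.1 = z.1 := by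
  obtain ⟨hb1, hb2, -, -⟩ := hw
  have e1 : (z.1 : ℝ) < b.1 + 1 := by nlinarith
  have e2 : (b.1 : ℝ) < z.1 + 1 := by nlinarith
  have f1 : z.1 < b.1 + 1 := by exact_mod_cast e1
  have f2 : b.1 < z.1 + 1 := by exact_mod_cast e2
  omega

/-- **Above a wall face there are no tube sites** (columns strictly inside the block, heights
strictly between the top edge and the top of the upper block). [folklore] -/
theorem not_mem_Nset_of_wallFace (hs : 0 < s) {z : ℤ × ℤ} (hz : WallFace s α z) {v : Site 2}
    (h1 : s * z.1 < δ * v 0) (h2 : δ * v 0 < s * (z.1 + 1)) (h3 : s * (z.2 + 1) < δ * v 1)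
    (h4 : δ * v 1 < s * (z.2 + 2)) : v ∉ Nset s α δ := by
  rintro ⟨b, hb, hvb⟩
  have hb1 := fst_eq_of_mem_block_of_strict hs (z := z) hvb (by rwa [meshPoint_re]) (by rwa [meshPoint_re])
  obtain ⟨-, -, hb3, hb4⟩ := hvb
  rw [meshPoint_im] at hb3 hb4
  have e3 : (z.2 : ℝ) < b.2 := by nlinarith
  have e4 : (b.2 : ℝ) < z.2 + 2 := by nlinarith
  have f3 : z.2 < b.2 := by exact_mod_cast e3
  have f4 : b.2 < z.2 + 2 := by exact_mod_cast e4
  have hb2 : b.2 = z.2 + 1 := by omega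
  exact hz.up (by rwa [show ((z.1, z.2 + 1) : ℤ × ℤ) = b from Prod.ext hb1.symm hb2.symm])

/-- **Below the top edge of a wall face the sites of its columns are tube sites.** [folklore] -/
theorem mem_Nset_of_wallFace {z : ℤ × ℤ} (hz : WallFace s α z) {v : Site 2}
    (h1 : s * z.1 ≤ δ * v 0) (h2 : δ * v 0 ≤ s * (z.1 + 1)) (h3 : s * z.2 ≤ δ * v 1)
    (h4 : δ * v 1 ≤ s * (z.2 + 1)) : v ∈ Nset s α δ :=
  ⟨z, hz.mem, by simp only [block, mem_setOf_eq, meshPoint_re, meshPoint_im]; exact ⟨h1, h2, h3, h4⟩⟩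

/-- **The tube pattern across a wall face.** [cite: SchrammSmirnov2011, §4, proof of Prop. 4.1] -/
theorem mem_Nset_iff_of_wallFace (hs : 0 < s) {z : ℤ × ℤ} (hz : WallFace s α z) {v : Site 2}
    (h1 : s * z.1 < δ * v 0) (h2 : δ * v 0 < s * (z.1 + 1)) (h3 : s * z.2 ≤ δ * v 1)
    (h4 : δ * v 1 < s * (z.2 + 2)) : v ∈ Nset s α δ ↔ δ * v 1 ≤ s * (z.2 + 1) := by
  constructor
  · intro hv
    by_contra h
    push Not at h
    exact not_mem_Nset_of_wallFace hs hz h1 h2 h h4 hv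
  · exact fun h => mem_Nset_of_wallFace hz h1.le h2.le h3 h

/-- **The collar pattern across a wall face.** [cite: SchrammSmirnov2011, §4, proof of Prop. 4.1] -/
theorem mem_Kset_iff_of_wallFace (hs : 0 < s) {z : ℤ × ℤ} (hz : WallFace s α z) {v : Site 2}
    (h1 : s * z.1 < δ * v 0) (h2 : δ * v 0 < s * (z.1 + 1)) (h3 : s * z.2 ≤ δ * v 1)
    (h4 : δ * v 1 < s * (z.2 + 2)) : v ∈ Kset s α δ ↔ s * (z.2 + 1) < δ * v 1 := by
  constructor
  · rintro ⟨-, hvN⟩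
    by_contra h
    push Not at h
    exact hvN (mem_Nset_of_wallFace hz h1.le h2.le h3 h)
  · intro h
    have hvN : v ∉ Nset s α δ := not_mem_Nset_of_wallFace hs hz h1 h2 h h4
    refine ⟨⟨blockOf s (meshPoint δ v), ⟨fun hb => hvN ⟨_, hb, mem_block_blockOf hs _⟩, z, hz.mem, ?_, ?_⟩,
      mem_block_blockOf hs _⟩, hvN⟩
    · have := fst_eq_of_mem_block_of_strict hs (z := z) (mem_block_blockOf hs (meshPoint δ v))
        (by rwa [meshPoint_re]) (by rwa [meshPoint_re])
      simp [this]
    · obtain ⟨-, -, hb3, hb4⟩ := mem_block_blockOf hs (meshPoint δ v)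
      rw [meshPoint_im] at hb3 hb4
      have e3 : (z.2 : ℝ) < (blockOf s (meshPoint δ v)).2 := by nlinarith
      have e4 : ((blockOf s (meshPoint δ v)).2 : ℝ) < z.2 + 2 := by nlinarith
      have f3 : z.2 < (blockOf s (meshPoint δ v)).2 := by exact_mod_cast e3
      have f4 : (blockOf s (meshPoint δ v)).2 < z.2 + 2 := by exact_mod_cast e4
      rw [abs_le]; constructor <;> omega

/-- **No far site across a wall face.** [folklore] -/
theorem mem_Nset_or_Kset_of_wallFace (hs : 0 < s) {z : ℤ × ℤ} (hz : WallFace s α z) {v : Site 2}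
    (h1 : s * z.1 < δ * v 0) (h2 : δ * v 0 < s * (z.1 + 1)) (h3 : s * z.2 ≤ δ * v 1)
    (h4 : δ * v 1 < s * (z.2 + 2)) : v ∈ Nset s α δ ∨ v ∈ Kset s α δ := by
  rcases le_or_gt (δ * v 1) (s * (z.2 + 1)) with h | h
  · exact Or.inl ((mem_Nset_iff_of_wallFace hs hz h1 h2 h3 h4).2 h)
  · exact Or.inr ((mem_Kset_iff_of_wallFace hs hz h1 h2 h3 h4).2 h)

/-- **Clean straight windows on a wall face**: the down-shifted collar datum of the zones has a clean
window at every position whose box fits strictly inside the columns of the face, for meshes with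
`δ (R₁ + 4) ≤ s`. [cite: SchrammSmirnov2011, §4, proof of Prop. 4.1] -/
theorem cleanWindow_of_wallFace (hs : 0 < s) (hδ : 0 < δ) (hα : Bornology.IsBounded α) {z : ℤ × ℤ}
    (hz : WallFace s α z) {j : ℤ} {m R₁ : ℕ} (hcol₁ : s * z.1 < δ * (j - R₁ - 2))
    (hcol₂ : δ * (j + m + R₁ + 2) < s * (z.1 + 1)) (h2δ : 2 * δ ≤ s) (hR₁ : δ * (R₁ + 4) ≤ s) :
    ((zones hs hδ hα).collar.map (downShift s δ z.2)).CleanWindow j m R₁ := by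
  intro w hw0 hw0' hw1 hw1'
  set r₀ := firstRow s δ z.2 with hr₀
  set v : Site 2 := w + Pi.single 1 r₀ with hv
  have hwv : w = (downShift s δ z.2).σ v := by
    rw [downShift_apply, hv, add_assoc, ← Pi.single_add]; simp [hr₀]
  have hv0 : v 0 = w 0 := by simp [hv]
  have hv1 : v 1 = w 1 + r₀ := by simp [hv]
  have hx1 : (⌊s * (z.2 + 1) / δ⌋ : ℝ) ≤ s * (z.2 + 1) / δ := Int.floor_le _
  have hx2 : s * (z.2 + 1) / δ < (⌊s * (z.2 + 1) / δ⌋ : ℝ) + 1 := Int.lt_floor_add_one _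
  have hr₀R : (r₀ : ℝ) = (⌊s * (z.2 + 1) / δ⌋ : ℝ) + 1 := by rw [hr₀, firstRow]; push_cast; ring
  have hδr₀ : s * (z.2 + 1) < δ * r₀ ∧ δ * r₀ ≤ s * (z.2 + 1) + δ := by
    rw [hr₀R]
    rw [div_lt_iff₀ hδ] at hx2
    rw [le_div_iff₀ hδ] at hx1
    constructor <;> nlinarith
  have h1 : s * z.1 < δ * v 0 := by
    rw [hv0]
    have : δ * ((j : ℝ) - R₁ - 2) ≤ δ * (w 0 : ℝ) := mul_le_mul_of_nonneg_left (by exact_mod_cast hw0) hδ.le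
    linarith
  have h2 : δ * v 0 < s * (z.1 + 1) := by
    rw [hv0]
    have : δ * (w 0 : ℝ) ≤ δ * ((j : ℝ) + m + R₁ + 2) := mul_le_mul_of_nonneg_left (by exact_mod_cast hw0') hδ.le
    linarith
  have h3 : s * z.2 ≤ δ * v 1 := by
    rw [hv1]; push_cast
    have : δ * (-2 : ℝ) ≤ δ * (w 1 : ℝ) := mul_le_mul_of_nonneg_left (by exact_mod_cast hw1) hδ.le
    nlinarith [hδr₀.1]
  have h4 : δ * v 1 < s * (z.2 + 2) := by
    rw [hv1]; push_cast
    have : δ * (w 1 : ℝ) ≤ δ * ((R₁ : ℝ) + 2) := mul_le_mul_of_nonneg_left (by exact_mod_cast hw1') hδ.le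
    nlinarith [hδr₀.2]
  have hK : w ∈ ((zones hs hδ hα).collar.map (downShift s δ z.2)).K ↔ v ∈ (zones hs hδ hα).collar.K := by
    rw [hwv]; exact Seeded.CollarDatum.mem_map_K_iff
  have hF : w ∈ ((zones hs hδ hα).collar.map (downShift s δ z.2)).Far ↔ v ∈ (zones hs hδ hα).collar.Far := by
    rw [hwv]; exact Seeded.CollarDatum.mem_map_Far_iff
  constructor
  · rw [hK, Seeded.Zones.collar_K, mem_zones_K,
      mem_Kset_iff_of_wallFace hs hz h1 h2 h3 h4, lt_mul_iff_firstRow_le hδ, ← hr₀, hv1]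
    omega
  · rw [hF, Seeded.Zones.collar_Far]
    rintro ⟨hK, hN, -⟩
    rcases mem_Nset_or_Kset_of_wallFace hs hz h1 h2 h3 h4 with h | h
    · exact hN ((mem_zones_N hs hδ hα).2 h)
    · exact hK ((mem_zones_K hs hδ hα).2 h)

/-! ### The lower faces -/

/-- **A wall face of the lower inner wall**: a tube block whose lower neighbour is not a tube block. [folklore] -/
structure WallFaceBottom (s : ℝ) (α : Set ℂ) (z : ℤ × ℤ) : Prop where
  mem : z ∈ tubeBlocks s α
  down : (z.1, z.2 - 1) ∉ tubeBlocks s α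

/-- A lower wall face is an upper wall face of the reflected cut. [folklore] -/
theorem WallFaceBottom.reflect {z : ℤ × ℤ} (h : WallFaceBottom s α z) : WallFace s (conj '' α) (z.1, -z.2 - 1) where
  mem := mem_tubeBlocks_reflect.2 h.mem
  up := fun h' => h.down (by
    have := mem_tubeBlocks_reflect (s := s) (α := α) (z := (z.1, z.2 - 1))
    rw [← this]; convert h' using 2; simp)

/-- **Clean straight windows on a lower wall face.** [cite: SchrammSmirnov2011, §4, proof of Prop. 4.1] -/
theorem cleanWindow_of_wallFaceBottom (hs : 0 < s) (hδ : 0 < δ) (hα : Bornology.IsBounded α) {z : ℤ × ℤ}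
    (hz : WallFaceBottom s α z) {j : ℤ} {m R₁ : ℕ} (hcol₁ : s * z.1 < δ * (j - R₁ - 2))
    (hcol₂ : δ * (j + m + R₁ + 2) < s * (z.1 + 1)) (h2δ : 2 * δ ≤ s) (hR₁ : δ * (R₁ + 4) ≤ s) :
    ((zones hs hδ hα).collar.map (Seeded.LatticeSym.reflY.trans (downShift s δ (-z.2 - 1)))).CleanWindow j m R₁ := by
  rw [← Seeded.CollarDatum.map_map, collar_map_reflY]
  have := cleanWindow_of_wallFace hs hδ (isBounded_conj hα) hz.reflect (j := j) (m := m) (R₁ := R₁)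
    (by simpa using hcol₁) (by simpa using hcol₂) h2δ hR₁
  simpa using this

/-! ### The right and left faces -/

/-- **A wall face of the right inner wall**: a tube block whose right neighbour is not a tube block. [folklore] -/
structure WallFaceRight (s : ℝ) (α : Set ℂ) (z : ℤ × ℤ) : Prop where
  mem : z ∈ tubeBlocks s α
  right : (z.1 + 1, z.2) ∉ tubeBlocks s α

/-- A right wall face is an upper wall face of the transposed cut. [folklore] -/
theorem WallFaceRight.swap {z : ℤ × ℤ} (h : WallFaceRight s α z) : WallFace s (swapC '' α) (z.2, z.1) where
  mem := mem_tubeBlocks_swap.2 h.mem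
  up := fun h' => h.right (by
    have := mem_tubeBlocks_swap (s := s) (α := α) (z := (z.1 + 1, z.2))
    rw [← this]; simpa using h')

/-- **Clean straight windows on a right wall face.** [cite: SchrammSmirnov2011, §4, proof of Prop. 4.1] -/
theorem cleanWindow_of_wallFaceRight (hs : 0 < s) (hδ : 0 < δ) (hα : Bornology.IsBounded α) {z : ℤ × ℤ}
    (hz : WallFaceRight s α z) {j : ℤ} {m R₁ : ℕ} (hcol₁ : s * z.2 < δ * (j - R₁ - 2))
    (hcol₂ : δ * (j + m + R₁ + 2) < s * (z.2 + 1)) (h2δ : 2 * δ ≤ s) (hR₁ : δ * (R₁ + 4) ≤ s) :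
    ((zones hs hδ hα).collar.map (Seeded.LatticeSym.swap.trans (downShift s δ z.1))).CleanWindow j m R₁ := by
  rw [← Seeded.CollarDatum.map_map, collar_map_swap]
  exact cleanWindow_of_wallFace hs hδ (isBounded_swapC hα) hz.swap (j := j) (m := m) (R₁ := R₁) hcol₁ hcol₂ h2δ hR₁

/-- **A wall face of the left inner wall**: a tube block whose left neighbour is not a tube block. [folklore] -/
structure WallFaceLeft (s : ℝ) (α : Set ℂ) (z : ℤ × ℤ) : Prop where
  mem : z ∈ tubeBlocks s α
  left : (z.1 - 1, z.2) ∉ tubeBlocks s α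

/-- A left wall face is a lower wall face of the transposed cut. [folklore] -/
theorem WallFaceLeft.swap {z : ℤ × ℤ} (h : WallFaceLeft s α z) : WallFaceBottom s (swapC '' α) (z.2, z.1) where
  mem := mem_tubeBlocks_swap.2 h.mem
  down := fun h' => h.left (by
    have := mem_tubeBlocks_swap (s := s) (α := α) (z := (z.1 - 1, z.2))
    rw [← this]; simpa using h')

/-- **Clean straight windows on a left wall face.** [cite: SchrammSmirnov2011, §4, proof of Prop. 4.1] -/
theorem cleanWindow_of_wallFaceLeft (hs : 0 < s) (hδ : 0 < δ) (hα : Bornology.IsBounded α) {z : ℤ × ℤ}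
    (hz : WallFaceLeft s α z) {j : ℤ} {m R₁ : ℕ} (hcol₁ : s * z.2 < δ * (j - R₁ - 2))
    (hcol₂ : δ * (j + m + R₁ + 2) < s * (z.2 + 1)) (h2δ : 2 * δ ≤ s) (hR₁ : δ * (R₁ + 4) ≤ s) :
    ((zones hs hδ hα).collar.map
      (Seeded.LatticeSym.swap.trans (Seeded.LatticeSym.reflY.trans (downShift s δ (-z.1 - 1))))).CleanWindow j m R₁ := by
  rw [← Seeded.CollarDatum.map_map, collar_map_swap]
  exact cleanWindow_of_wallFaceBottom hs hδ (isBounded_swapC hα) hz.swap (j := j) (m := m) (R₁ := R₁) hcol₁ hcol₂ h2δ hR₁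

end CutBlocks

end Literature.Probability.Percolation

end
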